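import Mathlib
import Literature.MathematicalPhysics.QuantumFieldTheory.Balaban1983to89.B14ChangeOfVariables

/-!
# `Balaban1983to89.B14Eq123Localization` — T. Bałaban, *Convergent renormalization expansions for lattice gauge theories*, Commun. Math. Phys. **119** (1988) 243–285 [Balaban1988Convergent]: (1.23) p. 252 — the characteristic functions after the change of variables (1.22) ("the desired localization property"): both factors of (1.23) are EXACTLY the old characteristic functions rewritten in the new variables, PROVED bond by bond from the cut-off `g` of p. 252

statement-level skeleton of published theorems with citation tags; proofs where landed; nothing here is a claim about the Yang–Mills mass gap

PDF held: `paper:balaban1988-cmp119-convergent-renormalization` (journal page = PDF page + 242); displays read on the page renders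
`…-p008-x4.png` (p. 250), `…-p009-x4.png` (p. 251), `…-p010-x4.png` (p. 252) of
`run/shared/lean/pub/pub-balaban/b2b-balaban-ref1/pages/1988-cmp119-convergent-renormalization/`, READ AS IMAGES.

WHAT IS REPRODUCED (Phase-2 seat p28 of `lit-balaban`, SKELETON row `B14.Eq1.23-1.25`, display (1.23); file 2/2 of the seat,
file 1/2 = `…B14Eq124Jacobians` ((1.24), (1.25)); (1.22) — `newVar`, `bF`, `IsCutoff` — is r11's `…B14.ChangeOfVariables`,
used BY NAME).  p. 252 [PDF 10], verbatim: *"Here g is a C^∞-function defined on the Lie algebra 𝐠, 0 ≤ g(A′) ≤ 1, g(A′) = 0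
on {A′ ∈ 𝐠 : |A′| ≤ 4/3 g₀⁻¹δ₀}, g(A′) = 1 on {A′ ∈ 𝐠 : |exp ig₀A′ − 1| ≥ 5/3 δ₀}. The configuration U₁(Ω₁∩Λ₁ᶜ)U_{1,□′}⁻¹ is
very small on □′^{∼2} in this case, hence g(A′) = 1 on a neighborhood of {A′ ∈ 𝐠 : |exp ig₀A′U₁(Ω₁∩Λ₁ᶜ)U_{1,□′}⁻¹ − 1| ≥ 2δ₀}.
… These changes of variables do not change the functions χ^{(0)}, and they transform the function χ^{(0)c}(□′)χ₀′(□′) into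
the function
  χ({ sup_{b∈(□′^{∼2})*} |A′(b)| ≥ g₀⁻¹δ₀ }) · χ({ sup_{b∈(□′^{∼2})*} |exp ig₀A′(b) U₁(Ω₁∩Λ₁ᶜ, b) U_{1,□′}⁻¹(b) − 1| < 2δ₀ }).  (1.23)
For b ∈ S₁*∖(R₁^{∼2})* we make a simpler change of variables; we take (1.22) with the function g(A′(b)) replaced by 1. These
changes of variables transform the function χ₀′(□′) into the second factor in the product (1.23). … After these changes of
variables the characteristic functions depend on the new variables V restricted to the large field domain Λ₁ᶜ. It is the
desired localization property."*  The old functions: (1.18) p. 250 `χ^{(0)c}(□′) = χ({sup_{b∈(□′^{∼2})*} |A(b)| ≥ g₀⁻¹δ₀})`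
and (1.19) p. 250 (second factor) `χ({sup_{b∈(□′^{∼2})*} |exp ig₀A(b) U₁(b) U_{1,□′}⁻¹(b) − 1| < 2δ₀})`, with (1.21) p. 251
`U₁ = exp(i𝐇_{1,Ax}(…)) U₁(Ω₁∩Λ₁ᶜ, V)` and (1.22) `A(b) = (1/(ig₀)) log[exp ig₀A′(b) exp(−ig(A′(b))𝐇_{1,Ax}(b))]`.

WHAT IS KERNEL-CERTIFIED (0 sorry, 0 definitions; one bond at a time in r11's complete normed `ℂ`-algebra `𝔸 ⊇ 𝐠`, `|·|` =
the norm; a `sup` over the finitely many bonds of `(□′^{∼2})*` being `≥ t` iff SOME bond is, the cube statements follow from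
the bond statements by `∃`/`∀`-congruence — `firstFactor_cube`).
§1 FIRST FACTOR.  Under `IsCutoff g₀ δ₀ g` and the smallness `‖g₀A′‖ ≤ 1/10`, `‖H‖ ≤ 1/10`, `‖H‖ ≤ δ₀/4` (print: *"|𝐇_{1,Ax}| <
   O(1)B₃exp(−δMR₁)ε₁, and the bound is much smaller than δ₀"*, p. 251): the old large-fluctuation-field indicator in the
   new variable IS the first factor of (1.23), EXACTLY: `g₀⁻¹δ₀ ≤ ‖A(b)‖ ↔ g₀⁻¹δ₀ ≤ ‖A′(b)‖` with `A(b) = newVar g₀ g H A′(b)`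
   (`firstFactor_iff`): where `g(A′) = 0` the substitution is the identity (r11's `newVar_eq_self_of_cutoff_zero`), and where
   it is not, `‖A′‖ > 4/3 g₀⁻¹δ₀` while `‖A − A′‖ ≤ (3/10) g₀⁻¹δ₀` (`norm_newVar_sub_le`, from r11's `eq122`, `norm_inv_g0_bF_le`).
§2 SECOND FACTOR, mechanism.  `exp(ig₀A(b)) = exp(ig₀A′(b)) · exp(−ig(A′(b))H)` (`exp_smul_newVar`: (1.22) exponentiated,
   `exp ∘ log = id` on `‖· − 1‖ < 1`, r11's `MatrixLog.exp_mlog`), hence with (1.21) in the form `U₁(b)U_{1,□′}⁻¹(b) =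
   exp(iH)·W`, `W = U₁(Ω₁∩Λ₁ᶜ,b)U_{1,□′}⁻¹(b)`: `exp(ig₀A)U₁U_{1,□′}⁻¹ = exp(ig₀A′)·exp(i(1 − g(A′))H)·W` (`oldArg_eq`), which
   is the argument `exp(ig₀A′)W` of the second factor of (1.23) wherever `g(A′) = 1` (`oldArg_eq_of_cutoff_one`) — in
   particular on all of `S₁*∖(R₁^{∼2})*` (the "simpler change of variables", `g ≡ 1`).
§3 SECOND FACTOR, exactness (the sentence *"hence g(A′) = 1 on a neighborhood of {… ≥ 2δ₀}"*): with `0 < δ₀ ≤ 1`,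
   `‖W − 1‖ ≤ δ₀/100` (*"U₁(Ω₁∩Λ₁ᶜ)U_{1,□′}⁻¹ is very small"*) and `‖H‖ ≤ δ₀/100`, the old small-field indicator in the new
   variable IS the second factor of (1.23), EXACTLY: `‖exp(ig₀A)U₁U_{1,□′}⁻¹ − 1‖ < 2δ₀ ↔ ‖exp(ig₀A′)W − 1‖ < 2δ₀`
   (`secondFactor_iff`): if `g(A′) = 1` the two arguments coincide (§2); if not, `IsCutoff` forces `‖exp ig₀A′ − 1‖ < 5/3 δ₀`
   and then BOTH indicators equal 1 (`norm_mul_sub_one_le` bookkeeping).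
Axioms of every theorem ⊆ {propext, Classical.choice, Quot.sound}.

WHAT IS *NOT* REPRODUCED OR ASSERTED: the bounds on 𝐇_{1,Ax} and on `U₁(Ω₁∩Λ₁ᶜ)U_{1,□′}⁻¹ − 1` themselves (B11 (190), B8 Lemma 1
— they enter as the displayed smallness HYPOTHESES, with explicit admissible constants 1/10, δ₀/4, δ₀/100 chosen here; print
says only "much smaller than δ₀"/"very small"); that the new variable stays in 𝐠 (Hermitian) — the algebra `𝔸` is r11's
ambient one; the statement "do not change the functions χ^{(0)}" for cubes whose bonds are untouched (trivial) and the
dependence bookkeeping "V restricted to Λ₁ᶜ" (which configuration `W` depends on is not modelled).  Value = kernel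
certificate that the printed cut-off design makes (1.23) an exact rewriting, NOT summit progress.

Unit `lit-balaban-p28` (Phase-2 proof seat p28, agent literature-prover-lit-balaban-p28-0; target assigned by lead ruling
G.5-9), HOME `run/shared/lean/pub/lit-balaban/` (PHASE2-TARGETS.md §G.6; seat log `lit-balaban-p28/STATUS.md`).

## References
* [Balaban1988Convergent] T. Bałaban, Commun. Math. Phys. 119 (1988) 243–285, doi:10.1007/bf01217741, (1.18)–(1.19) p. 250,
  (1.21)–(1.22) p. 251, (1.23) p. 252.
-/

noncomputable section

namespace Literature.MathematicalPhysics.QuantumFieldTheory.Balaban1983to89.B14Eq123Localization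

open NormedSpace
open Literature.MathematicalPhysics.QuantumFieldTheory.Balaban1983to89 MatrixLog B14.ChangeOfVariables

variable {𝔸 : Type*} [NormedRing 𝔸] [NormedAlgebra ℂ 𝔸] [CompleteSpace 𝔸]

/-! ## §1. The first factor of (1.23): the large-fluctuation-field indicator is invariant under (1.22) -/

omit [CompleteSpace 𝔸] in
/-- `‖ig₀A′‖ = ‖g₀A′‖`. [cite: Balaban1988Convergent, (1.22) p.251] -/
theorem norm_I_mul_smul (g₀ : ℝ) (A : 𝔸) :
    ‖((Complex.I : ℂ) * (g₀ : ℂ)) • A‖ = ‖(g₀ : ℂ) • A‖ := by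
  rw [← smul_smul, B14.ChangeOfVariables.norm_I_smul]

omit [CompleteSpace 𝔸] in
/-- `‖g₀A′‖ = g₀‖A′‖` for `g₀ ≥ 0`. [cite: Balaban1988Convergent, (1.22) p.251] -/
theorem norm_real_smul {g₀ : ℝ} (hg0 : 0 ≤ g₀) (A : 𝔸) : ‖(g₀ : ℂ) • A‖ = g₀ * ‖A‖ := by
  rw [norm_smul, Complex.norm_real, Real.norm_of_nonneg hg0]

/-- **The size of the correction in (1.22)** (p. 252: *"the factor g₀⁻¹ is cancelled … the factor g₀⁻¹ is suppressed by the
bounds on 𝐇_{1,Ax}"*): for `g₀ > 0`, `0 ≤ g(A′) ≤ 1`, `‖g₀A′‖ ≤ 1/10`, `‖H‖ ≤ 1/10`: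
`‖A − A′‖ = ‖newVar g₀ g H A′ − A′‖ ≤ (6/5)·g₀⁻¹‖H‖`. [cite: Balaban1988Convergent, (1.22) p.251] -/
theorem norm_newVar_sub_le {g₀ : ℝ} (hg0 : 0 < g₀) {g : 𝔸 → ℝ} {H A' : 𝔸} (hg01 : 0 ≤ g A' ∧ g A' ≤ 1)
    (hA : ‖(g₀ : ℂ) • A'‖ ≤ 1 / 10) (hH : ‖H‖ ≤ 1 / 10) :
    ‖newVar g₀ g H A' - A'‖ ≤ 6 / 5 * (g₀⁻¹ * ‖H‖) := by
  have hY : ‖-((((g A' : ℝ) : ℂ)) • H)‖ ≤ 1 / 10 := by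
    rw [norm_neg, norm_smul, Complex.norm_real, Real.norm_of_nonneg hg01.1]
    calc g A' * ‖H‖ ≤ 1 * ‖H‖ := by gcongr; exact hg01.2
      _ ≤ 1 / 10 := by rw [one_mul]; exact hH
  have hYle : ‖-((((g A' : ℝ) : ℂ)) • H)‖ ≤ ‖H‖ := by
    rw [norm_neg, norm_smul, Complex.norm_real, Real.norm_of_nonneg hg01.1]
    calc g A' * ‖H‖ ≤ 1 * ‖H‖ := by gcongr; exact hg01.2
      _ = ‖H‖ := one_mul _
  have h1 : ‖((g₀ : ℂ)⁻¹ * ((g A' : ℝ) : ℂ)) • H‖ ≤ g₀⁻¹ * ‖H‖ := by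
    rw [norm_smul, norm_mul, norm_inv, Complex.norm_real, Complex.norm_real, Real.norm_of_nonneg hg0.le,
      Real.norm_of_nonneg hg01.1]
    calc g₀⁻¹ * g A' * ‖H‖ ≤ g₀⁻¹ * 1 * ‖H‖ := by gcongr; exact hg01.2
      _ = g₀⁻¹ * ‖H‖ := by rw [mul_one]
  have h2 := norm_inv_g0_bF_le hg0 hA hY
  have hA' : ‖A'‖ ≤ g₀⁻¹ * (1 / 10) := by
    rw [norm_real_smul hg0.le] at hA
    rw [le_inv_mul_iff₀ hg0]; exact hA
  rw [eq122 hg0.ne' g H A']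
  calc ‖A' - ((g₀ : ℂ)⁻¹ * ((g A' : ℝ) : ℂ)) • H - (g₀ : ℂ)⁻¹ • bF ((g₀ : ℂ) • A') (-(((g A' : ℝ) : ℂ) • H)) - A'‖
      = ‖-((((g₀ : ℂ)⁻¹ * ((g A' : ℝ) : ℂ)) • H) + (g₀ : ℂ)⁻¹ • bF ((g₀ : ℂ) • A') (-(((g A' : ℝ) : ℂ) • H)))‖ := by
        congr 1; abel
    _ ≤ ‖((g₀ : ℂ)⁻¹ * ((g A' : ℝ) : ℂ)) • H‖ + ‖(g₀ : ℂ)⁻¹ • bF ((g₀ : ℂ) • A') (-(((g A' : ℝ) : ℂ) • H))‖ := by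
        rw [norm_neg]; exact norm_add_le _ _
    _ ≤ g₀⁻¹ * ‖H‖ + 2 * ‖A'‖ * ‖-(((g A' : ℝ) : ℂ) • H)‖ := add_le_add h1 h2
    _ ≤ g₀⁻¹ * ‖H‖ + 2 * (g₀⁻¹ * (1 / 10)) * ‖H‖ := by gcongr
    _ = 6 / 5 * (g₀⁻¹ * ‖H‖) := by ring

/-- **(1.23), first factor, bond by bond** (p. 252: *"they transform the function χ^{(0)c}(□′)χ₀′(□′) into the function
χ({sup_{b∈(□′^{∼2})*} |A′(b)| ≥ g₀⁻¹δ₀}) · χ({…})"*): under the cut-off design of p. 252 (`IsCutoff g₀ δ₀ g`) and the smallness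
`‖g₀A′‖ ≤ 1/10`, `‖H‖ ≤ 1/10`, `‖H‖ ≤ δ₀/4`, the large-field condition is THE SAME in the old and the new variable:
`g₀⁻¹δ₀ ≤ |A(b)| ↔ g₀⁻¹δ₀ ≤ |A′(b)|`, `A(b) = newVar g₀ g H A′(b)`. [cite: Balaban1988Convergent, (1.23) p.252] -/
theorem firstFactor_iff {g₀ δ₀ : ℝ} (hg0 : 0 < g₀) (hδ : 0 ≤ δ₀) {g : 𝔸 → ℝ} (hg : IsCutoff g₀ δ₀ g) {H A' : 𝔸}
    (hA : ‖(g₀ : ℂ) • A'‖ ≤ 1 / 10) (hH : ‖H‖ ≤ 1 / 10) (hHδ : ‖H‖ ≤ δ₀ / 4) :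
    g₀⁻¹ * δ₀ ≤ ‖newVar g₀ g H A'‖ ↔ g₀⁻¹ * δ₀ ≤ ‖A'‖ := by
  by_cases hsmallA : ‖A'‖ ≤ 4 / 3 * g₀⁻¹ * δ₀
  · -- the cut-off vanishes: the substitution is the identity
    have hg0' : g A' = 0 := hg.eq_zero hsmallA
    have hlog : ‖((Complex.I : ℂ) * (g₀ : ℂ)) • A'‖ < Real.log 2 := by
      rw [norm_I_mul_smul]
      have := Real.log_two_gt_d9
      linarith
    rw [newVar_eq_self_of_cutoff_zero hg0.ne' hg0' hlog]
  · -- large `A′`: both sides hold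
    rw [not_le] at hsmallA
    have hpos : 0 ≤ g₀⁻¹ * δ₀ := mul_nonneg (inv_nonneg.2 hg0.le) hδ
    have hR : g₀⁻¹ * δ₀ ≤ ‖A'‖ := by nlinarith
    have hsub : ‖newVar g₀ g H A' - A'‖ ≤ 3 / 10 * (g₀⁻¹ * δ₀) := by
      calc ‖newVar g₀ g H A' - A'‖ ≤ 6 / 5 * (g₀⁻¹ * ‖H‖) := norm_newVar_sub_le hg0 (hg.2.1 A') hA hH
        _ ≤ 6 / 5 * (g₀⁻¹ * (δ₀ / 4)) := by gcongr
        _ = 3 / 10 * (g₀⁻¹ * δ₀) := by ring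
    have hL : g₀⁻¹ * δ₀ ≤ ‖newVar g₀ g H A'‖ := by
      have htri : ‖A'‖ - ‖newVar g₀ g H A' - A'‖ ≤ ‖newVar g₀ g H A'‖ := by
        have := norm_sub_norm_le A' (newVar g₀ g H A')
        rw [← norm_neg (A' - newVar g₀ g H A'), neg_sub] at this
        linarith
      nlinarith
    exact ⟨fun _ => hR, fun _ => hL⟩

/-- **(1.23), first factor, for a cube**: the `sup` over the finitely many bonds `b ∈ (□′^{∼2})*` is `≥ g₀⁻¹δ₀` iff some bond
is, so bond by bond `firstFactor_iff` gives `χ({sup_b |A(b)| ≥ g₀⁻¹δ₀}) = χ({sup_b |A′(b)| ≥ g₀⁻¹δ₀})` as an equivalence of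
the defining conditions (`bonds` = the bond set, `H b` = 𝐇_{1,Ax}(b)). [cite: Balaban1988Convergent, (1.23) p.252] -/
theorem firstFactor_cube {β : Type*} (bonds : Finset β) {g₀ δ₀ : ℝ} (hg0 : 0 < g₀) (hδ : 0 ≤ δ₀) {g : 𝔸 → ℝ}
    (hg : IsCutoff g₀ δ₀ g) {H A' : β → 𝔸} (hA : ∀ b ∈ bonds, ‖(g₀ : ℂ) • A' b‖ ≤ 1 / 10)
    (hH : ∀ b ∈ bonds, ‖H b‖ ≤ 1 / 10) (hHδ : ∀ b ∈ bonds, ‖H b‖ ≤ δ₀ / 4) :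
    (∃ b ∈ bonds, g₀⁻¹ * δ₀ ≤ ‖newVar g₀ g (H b) (A' b)‖) ↔ ∃ b ∈ bonds, g₀⁻¹ * δ₀ ≤ ‖A' b‖ :=
  exists_congr fun b => and_congr_right fun hb => firstFactor_iff hg0 hδ hg (hA b hb) (hH b hb) (hHδ b hb)

/-! ## §2. The second factor of (1.23): (1.22) exponentiated and combined with (1.21) -/

/-- **(1.22) exponentiated**: `exp(ig₀A(b)) = exp(ig₀A′(b)) · exp(−ig(A′(b))H)` for the new variable
`A(b) = (1/(ig₀)) log[exp ig₀A′(b) exp(−ig(A′(b))H)]`, `g₀ ≠ 0`, whenever the product is in the domain of the logarithm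
(`‖· − 1‖ < 1`, r11's `MatrixLog.exp_mlog`). [cite: Balaban1988Convergent, (1.23) p.252] -/
theorem exp_smul_newVar {g₀ : ℝ} (hg0 : g₀ ≠ 0) (g : 𝔸 → ℝ) (H A' : 𝔸)
    (hZ : ‖exp (((Complex.I : ℂ) * (g₀ : ℂ)) • A') * exp (-(((Complex.I : ℂ) * ((g A' : ℝ) : ℂ)) • H)) - 1‖ < 1) :
    exp (((Complex.I : ℂ) * (g₀ : ℂ)) • newVar g₀ g H A')
      = exp (((Complex.I : ℂ) * (g₀ : ℂ)) • A') * exp (-(((Complex.I : ℂ) * ((g A' : ℝ) : ℂ)) • H)) := by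
  have hc : (Complex.I : ℂ) * (g₀ : ℂ) ≠ 0 := mul_ne_zero Complex.I_ne_zero (by exact_mod_cast hg0)
  unfold newVar
  rw [smul_smul, mul_inv_cancel₀ hc, one_smul, exp_mlog hZ]

/-- `exp(−igH) · exp(iH) = exp(i(1 − g)H)` (the two scalar multiples of `H` commute). [cite: Balaban1988Convergent, (1.23) p.252] -/
theorem exp_neg_smul_mul_exp_smul (t : ℝ) (H : 𝔸) :
    exp (-(((Complex.I : ℂ) * (t : ℂ)) • H)) * exp ((Complex.I : ℂ) • H)
      = exp (((Complex.I : ℂ) * ((1 - t : ℝ) : ℂ)) • H) := by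
  have hcomm : Commute (-(((Complex.I : ℂ) * (t : ℂ)) • H)) ((Complex.I : ℂ) • H) :=
    (((Commute.refl H).smul_left _).smul_right _).neg_left
  have hcoef : -((Complex.I : ℂ) * (t : ℂ)) + Complex.I = Complex.I * ((1 - t : ℝ) : ℂ) := by
    push_cast
    ring
  rw [← exp_add_of_commute_of_mem_ball hcomm (Literature.Analysis.Complex.mem_eball_expSeries_radius _)
    (Literature.Analysis.Complex.mem_eball_expSeries_radius _), ← neg_smul, ← add_smul, hcoef]

/-- **The argument of the old small-field function in the new variables**: with (1.21) in the form
`U₁(b)U_{1,□′}⁻¹(b) = exp(iH)·W` (`W = U₁(Ω₁∩Λ₁ᶜ, b)U_{1,□′}⁻¹(b)`, `H = 𝐇_{1,Ax}(b)`),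
`exp(ig₀A(b)) U₁(b)U_{1,□′}⁻¹(b) = exp(ig₀A′(b)) · exp(i(1 − g(A′(b)))H) · W`. [cite: Balaban1988Convergent, (1.23) p.252] -/
theorem oldArg_eq {g₀ : ℝ} (hg0 : g₀ ≠ 0) (g : 𝔸 → ℝ) {H A' U W : 𝔸} (hU : U = exp ((Complex.I : ℂ) • H) * W)
    (hZ : ‖exp (((Complex.I : ℂ) * (g₀ : ℂ)) • A') * exp (-(((Complex.I : ℂ) * ((g A' : ℝ) : ℂ)) • H)) - 1‖ < 1) :
    exp (((Complex.I : ℂ) * (g₀ : ℂ)) • newVar g₀ g H A') * U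
      = exp (((Complex.I : ℂ) * (g₀ : ℂ)) • A') * exp (((Complex.I : ℂ) * ((1 - g A' : ℝ) : ℂ)) • H) * W := by
  rw [exp_smul_newVar hg0 g H A' hZ, hU, ← mul_assoc, mul_assoc (exp _) (exp _) (exp _), exp_neg_smul_mul_exp_smul]

/-- **(1.23), second factor, where the cut-off is saturated** (and on ALL bonds of `S₁*∖(R₁^{∼2})*`, where p. 252 takes
`g ≡ 1`): if `g(A′(b)) = 1` then `exp(ig₀A(b)) U₁(b)U_{1,□′}⁻¹(b) = exp(ig₀A′(b)) U₁(Ω₁∩Λ₁ᶜ, b)U_{1,□′}⁻¹(b)` — the argument of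
the second factor of (1.23), which depends on `V` through `Λ₁ᶜ` only. [cite: Balaban1988Convergent, (1.23) p.252] -/
theorem oldArg_eq_of_cutoff_one {g₀ : ℝ} (hg0 : g₀ ≠ 0) {g : 𝔸 → ℝ} {H A' U W : 𝔸} (hg1 : g A' = 1)
    (hU : U = exp ((Complex.I : ℂ) • H) * W)
    (hZ : ‖exp (((Complex.I : ℂ) * (g₀ : ℂ)) • A') * exp (-(((Complex.I : ℂ) * ((g A' : ℝ) : ℂ)) • H)) - 1‖ < 1) :
    exp (((Complex.I : ℂ) * (g₀ : ℂ)) • newVar g₀ g H A') * U = exp (((Complex.I : ℂ) * (g₀ : ℂ)) • A') * W := by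
  rw [oldArg_eq hg0 g hU hZ, hg1, sub_self]
  simp

/-! ## §3. The second factor of (1.23): exactness from *"g(A′) = 1 on a neighborhood of {… ≥ 2δ₀}"* -/

omit [NormedAlgebra ℂ 𝔸] [CompleteSpace 𝔸] in
/-- Bookkeeping: `‖xy − 1‖ ≤ ‖x − 1‖‖y − 1‖ + ‖x − 1‖ + ‖y − 1‖` (no `‖1‖` needed). [cite: Balaban1988Convergent, (1.23) p.252] -/
theorem norm_mul_sub_one_le (x y : 𝔸) : ‖x * y - 1‖ ≤ ‖x - 1‖ * ‖y - 1‖ + ‖x - 1‖ + ‖y - 1‖ := by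
  have h : x * y - 1 = (x - 1) * (y - 1) + (x - 1) + (y - 1) := by noncomm_ring
  rw [h]
  exact (norm_add_le _ _).trans (add_le_add ((norm_add_le _ _).trans (add_le_add (norm_mul_le _ _) le_rfl)) le_rfl)

/-- `‖exp(i(1 − g)H) − 1‖ ≤ 2‖H‖` for `0 ≤ g ≤ 1`, `‖H‖ ≤ 1` (from `‖exp a − 1‖ ≤ e^{‖a‖} − 1`, the tree's
`Literature.Analysis.Calculus.norm_exp_sub_one_le`, and `e^x − 1 ≤ 2x` on `[0,1]`). [cite: Balaban1988Convergent, (1.23) p.252] -/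
theorem norm_exp_corr_sub_one_le {t : ℝ} (ht : 0 ≤ t ∧ t ≤ 1) {H : 𝔸} (hH : ‖H‖ ≤ 1) :
    ‖exp (((Complex.I : ℂ) * ((1 - t : ℝ) : ℂ)) • H) - 1‖ ≤ 2 * ‖H‖ := by
  have hX : ‖((Complex.I : ℂ) * ((1 - t : ℝ) : ℂ)) • H‖ ≤ ‖H‖ := by
    rw [norm_smul, norm_mul, Complex.norm_I, one_mul, Complex.norm_real, Real.norm_of_nonneg (by linarith)]
    calc (1 - t) * ‖H‖ ≤ 1 * ‖H‖ := by gcongr; linarith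
      _ = ‖H‖ := one_mul _
  have h1 := Literature.Analysis.Calculus.norm_exp_sub_one_le (((Complex.I : ℂ) * ((1 - t : ℝ) : ℂ)) • H)
  have h2 : Real.exp ‖((Complex.I : ℂ) * ((1 - t : ℝ) : ℂ)) • H‖ - 1 ≤ 2 * ‖((Complex.I : ℂ) * ((1 - t : ℝ) : ℂ)) • H‖ := by
    have hle1 : |‖((Complex.I : ℂ) * ((1 - t : ℝ) : ℂ)) • H‖| ≤ 1 := by
      rw [abs_of_nonneg (norm_nonneg _)]; exact hX.trans hH
    have h := Real.abs_exp_sub_one_le hle1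
    rw [abs_of_nonneg (norm_nonneg _)] at h
    exact (le_abs_self _).trans h
  linarith

/-- **(1.23), second factor, bond by bond, EXACTLY** (p. 252: *"The configuration U₁(Ω₁∩Λ₁ᶜ)U_{1,□′}⁻¹ is very small on □′^{∼2}
in this case, hence g(A′) = 1 on a neighborhood of {A′ ∈ 𝐠 : |exp ig₀A′U₁(Ω₁∩Λ₁ᶜ)U_{1,□′}⁻¹ − 1| ≥ 2δ₀}"*, whence *"they
transform the function … χ₀′(□′) into … χ({sup |exp ig₀A′(b)U₁(Ω₁∩Λ₁ᶜ,b)U_{1,□′}⁻¹(b) − 1| < 2δ₀})"*): with `U₁U_{1,□′}⁻¹ =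
exp(iH)·W` at the bond ((1.21)), `IsCutoff g₀ δ₀ g`, `0 < δ₀ ≤ 1` and the smallness `‖W − 1‖ ≤ δ₀/100`, `‖H‖ ≤ δ₀/100`:
`‖exp(ig₀A(b))U₁(b)U_{1,□′}⁻¹(b) − 1‖ < 2δ₀ ↔ ‖exp(ig₀A′(b))W − 1‖ < 2δ₀`. [cite: Balaban1988Convergent, (1.23) p.252] -/
theorem secondFactor_iff {g₀ δ₀ : ℝ} (hg0 : g₀ ≠ 0) (hδ : 0 < δ₀) (hδ1 : δ₀ ≤ 1) {g : 𝔸 → ℝ} (hg : IsCutoff g₀ δ₀ g)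
    {H A' U W : 𝔸} (hU : U = exp ((Complex.I : ℂ) • H) * W) (hW : ‖W - 1‖ ≤ δ₀ / 100) (hH : ‖H‖ ≤ δ₀ / 100)
    (hZ : ‖exp (((Complex.I : ℂ) * (g₀ : ℂ)) • A') * exp (-(((Complex.I : ℂ) * ((g A' : ℝ) : ℂ)) • H)) - 1‖ < 1) :
    ‖exp (((Complex.I : ℂ) * (g₀ : ℂ)) • newVar g₀ g H A') * U - 1‖ < 2 * δ₀
      ↔ ‖exp (((Complex.I : ℂ) * (g₀ : ℂ)) • A') * W - 1‖ < 2 * δ₀ := by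
  rw [oldArg_eq hg0 g hU hZ]
  set E := exp (((Complex.I : ℂ) * (g₀ : ℂ)) • A') with hE
  set F := exp (((Complex.I : ℂ) * ((1 - g A' : ℝ) : ℂ)) • H) with hF
  by_cases hg1 : g A' = 1
  · -- saturated cut-off: the arguments coincide
    have hF1 : F = 1 := by rw [hF, hg1, sub_self]; simp
    rw [hF1, mul_one]
  · -- unsaturated cut-off: `‖exp ig₀A′ − 1‖ < 5/3 δ₀`, and both indicators are 1
    have hE53 : ‖E - 1‖ < 5 / 3 * δ₀ := by
      by_contra h
      rw [not_lt] at h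
      exact hg1 (hg.eq_one h)
    have hEn : 0 ≤ ‖E - 1‖ := norm_nonneg _
    have hθ : ‖F - 1‖ ≤ 2 * ‖H‖ := norm_exp_corr_sub_one_le (hg.2.1 A') (hH.trans (by linarith))
    have hθ' : ‖F - 1‖ ≤ δ₀ / 50 := hθ.trans (by linarith)
    have hθn : 0 ≤ ‖F - 1‖ := norm_nonneg _
    have hWn : 0 ≤ ‖W - 1‖ := norm_nonneg _
    -- the new-variable indicator holds
    have hnew : ‖E * W - 1‖ < 2 * δ₀ := by
      have h := norm_mul_sub_one_le E W
      nlinarith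
    -- the old-variable indicator holds
    have hold : ‖E * F * W - 1‖ < 2 * δ₀ := by
      have hFW : ‖F * W - 1‖ ≤ δ₀ / 50 * (δ₀ / 100) + δ₀ / 50 + δ₀ / 100 := by
        have h := norm_mul_sub_one_le F W
        nlinarith
      have hFWn : 0 ≤ ‖F * W - 1‖ := norm_nonneg _
      have h := norm_mul_sub_one_le E (F * W)
      rw [← mul_assoc] at h
      nlinarith
    exact ⟨fun _ => hnew, fun _ => hold⟩

end Literature.MathematicalPhysics.QuantumFieldTheory.Balaban1983to89.B14Eq123Localization
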